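import Summits.RiemannHypothesis.RiemannHypothesis.Theses.WeilComb
import Summits.RiemannHypothesis.RiemannHypothesis.Theorems.WeilCombCombShapePositivityStubHelsonUpper
import Summits.RiemannHypothesis.RiemannHypothesis.Theorems.WeilCombCombShapePositivityStubArchWindow
import Summits.RiemannHypothesis.RiemannHypothesis.Theorems.WeilCombCombShapePositivityExactPrimeWindow
import Summits.RiemannHypothesis.RiemannHypothesis.Theorems.WeilCombCombShapePositivityPolarExact
import Summits.RiemannHypothesis.RiemannHypothesis.Theorems.WeilCombCombShapePositivityPoleCoefficient
import Summits.RiemannHypothesis.RiemannHypothesis.Theorems.WeilCombCombShapeAdmissible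
import Literature.NumberTheory.LFunctions.WeilExplicit
import Literature.NumberTheory.LFunctions.WeilMellinBounds
import Literature.NumberTheory.LFunctions.WeilArchimedeanMoments
import Literature.Analysis.SpecialFunctions.DigammaVerticalSeries
import Mathlib.NumberTheory.Harmonic.Bounds

/-!
# Coercivity of the comb form on the exact window, rank-two (pole-exact) version
(crux `WeilComb.CombShapePositivity`, item stmt-RiemannHypothesis-11229, line `Sketch`; the "PerronConeCoercivity"
layer of the route's Theorem B = `2ε(M+1) ≤ 1 ⇒ 0 ≤ Re Q(comb)`)

Notation. `φ₀(u) = expNegInvGlue (1 - u²)`, `φ_ε(t) = ε⁻¹ φ₀(t/ε)`, comb `g = Σ_{m ≤ M} a_m φ_ε(· − log m)`,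
`k = g ⋆ g̃`, `Q(g) = W(k)`, `N₀ = ‖φ₀‖₂²`, `U = ε⁻¹N₀`, `F_ε = ∫ φ₀(u) cosh(εu/2) du = φ̂_ε(0) = φ̂_ε(1) > 0`,
`L = Σ‖a_m‖²`, Helson form `H`, Dirichlet energy `D = Σ_m Σ_{n ≤ M/m} Λ(n)‖a(nm) − n^{-1/2}a(m)‖²`,
`A₋ = Σ a_m m^{-1/2}`, `A₊ = Σ a_m m^{1/2}` (complex), `ρ(u) = Re ψ(1/4 + iu/2)` (`reDigammaQuarter`),
`archPlus(a) = (1/2π)∫|ĝ(1/2+iu)|²(ρ(u) − ρ(0))du ≥ 0`, coherence deficit `Δ(a) = (log M + 1 + log π − ρ(0))L − archPlus(a)/U`.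

**The pole is rank two.** `Re P(k) = 2F_ε² Re(A₋ conj A₊)` is the Hermitian form of the real symmetric rank-2 matrix
`F_ε²(u vᵀ + v uᵀ)`, `u_m = m^{-1/2}`, `v_m = m^{1/2}`, whose bottom eigenvalue is EXACTLY `F_ε²(u·v − ‖u‖‖v‖)
= −F_ε²(√(H_M · M(M+1)/2) − M)`, `H_M = Σ_{m ≤ M} 1/m ≤ 1 + log M`. Hence (`two_mul_re_polar_ge`)
`2 Re(A₋ conj A₊) ≥ −(√((1 + log M)·M(M+1)/2) − M)·‖a‖²` — no Dirichlet energy is spent on the pole.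

**Statement** (`window_coercivity_rank2`). For `0 < ε`, `1 ≤ M`, `2ε(M+1) ≤ 1` and every `a`:
`U·( D − Δ(a) − C₂·L ) ≤ Re Q(g)`,  `C₂ = (F_ε² ε/N₀)·(√((1 + log M)·M(M+1)/2) − M)`
(`≈ 2rλ(√((1+log M)/2) − 1)`, `r = F²/2N₀ ≈ 0.74`, `λ = εM ≤ 1/2`: `0.76` at `M = 800`, `1.3` at `M = 10⁶`, `2.1` at `M = 10¹²`;
smaller than the M-uniform Poincaré constant `≈ 11.7` of `window_coercivity` for all `log M ≲ 500`, and with the FULL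
Dirichlet energy on the left). Corollary `window_dichotomy_rank2`: off the cone `{D ≤ Δ + C₂ L}` the window cell holds.

**Proof.** Exact identity (`weilQuadratic_comb_re_exactWindow`), `Re P = 2F_ε² Re(A₋ conj A₊)` (`weilPolarTerm_comb_re`,
`weilMellin_dilBump_zero_one`), the rank-two bound, `H ≤ (log M + 1)L − D` (`stub_helson_upper`),
`Re W_∞(k) = archPlus + (ρ(0) − log π)UL` (`stub_arch_window`).
-/

noncomputable section

-- the sub-problem path `RiemannHypothesis/RiemannHypothesis` (single-conjunct summit, D-0017) duplicates a namespace
set_option linter.dupNamespace false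

open scoped BigOperators ComplexConjugate
open Complex MeasureTheory

namespace Summit.RiemannHypothesis.RiemannHypothesis.Theorems.WeilCombBohrFejer

open Literature.NumberTheory.LFunctions
open Literature.Analysis.SpecialFunctions (reDigammaQuarter reDigammaQuarter_zero_le)

/-! ## The bottom eigenvalue of a real rank-two form -/

/-- **Rank-two Rayleigh bound.** For real `u, v, x` on a finite set:
`(u·v − ‖u‖‖v‖)·‖x‖² ≤ 2 (u·x)(v·x)` — the bottom eigenvalue of `u vᵀ + v uᵀ` is `u·v − ‖u‖‖v‖`
(Cauchy–Schwarz for the vector `‖v‖u − ‖u‖v`). [folklore] -/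
theorem rankTwo_rayleigh_ge (s : Finset ℕ) (u v x : ℕ → ℝ) :
    (∑ i ∈ s, u i * v i - Real.sqrt (∑ i ∈ s, u i ^ 2) * Real.sqrt (∑ i ∈ s, v i ^ 2)) *
        ∑ i ∈ s, x i ^ 2 ≤ 2 * (∑ i ∈ s, u i * x i) * (∑ i ∈ s, v i * x i) := by
  set nu : ℝ := Real.sqrt (∑ i ∈ s, u i ^ 2) with hnu
  set nv : ℝ := Real.sqrt (∑ i ∈ s, v i ^ 2) with hnv
  set α : ℝ := ∑ i ∈ s, u i * x i with hα
  set β : ℝ := ∑ i ∈ s, v i * x i with hβ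
  set X : ℝ := ∑ i ∈ s, x i ^ 2 with hX
  set uv : ℝ := ∑ i ∈ s, u i * v i with huv
  have hU0 : 0 ≤ ∑ i ∈ s, u i ^ 2 := Finset.sum_nonneg fun _ _ => sq_nonneg _
  have hV0 : 0 ≤ ∑ i ∈ s, v i ^ 2 := Finset.sum_nonneg fun _ _ => sq_nonneg _
  have hX0 : 0 ≤ X := Finset.sum_nonneg fun _ _ => sq_nonneg _
  have hnu0 : 0 ≤ nu := Real.sqrt_nonneg _
  have hnv0 : 0 ≤ nv := Real.sqrt_nonneg _
  have hnu2 : nu ^ 2 = ∑ i ∈ s, u i ^ 2 := Real.sq_sqrt hU0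
  have hnv2 : nv ^ 2 = ∑ i ∈ s, v i ^ 2 := Real.sq_sqrt hV0
  -- Cauchy–Schwarz for `w = nv·u − nu·v` against `x`
  have hCS := Finset.sum_mul_sq_le_sq_mul_sq s (fun i => nv * u i - nu * v i) x
  have e1 : ∑ i ∈ s, (nv * u i - nu * v i) * x i = nv * α - nu * β := by
    rw [hα, hβ, Finset.mul_sum, Finset.mul_sum, ← Finset.sum_sub_distrib]
    exact Finset.sum_congr rfl fun i _ => by ring
  have e2 : ∑ i ∈ s, (nv * u i - nu * v i) ^ 2 = 2 * nu * nv * (nu * nv - uv) := by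
    have : ∑ i ∈ s, (nv * u i - nu * v i) ^ 2 =
        nv ^ 2 * (∑ i ∈ s, u i ^ 2) - 2 * nu * nv * (∑ i ∈ s, u i * v i) + nu ^ 2 * ∑ i ∈ s, v i ^ 2 := by
      rw [Finset.mul_sum, Finset.mul_sum, Finset.mul_sum, ← Finset.sum_sub_distrib, ← Finset.sum_add_distrib]
      exact Finset.sum_congr rfl fun i _ => by ring
    rw [this, ← hnu2, ← hnv2, huv]
    ring
  rw [e1, e2] at hCS
  -- `(nv α − nu β)² ≥ −4 nu nv α β` since `(nv α + nu β)² ≥ 0`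
  have h4 : -(4 * nu * nv * (α * β)) ≤ (nv * α - nu * β) ^ 2 := by nlinarith [sq_nonneg (nv * α + nu * β)]
  -- degenerate cases
  rcases hnu0.eq_or_lt with hnu_z | hnu_pos
  · -- `nu = 0`: all `u i = 0` on `s`
    have hsum : ∑ i ∈ s, u i ^ 2 = 0 := by rw [← hnu2, ← hnu_z]; ring
    have hui : ∀ i ∈ s, u i = 0 := fun i hi =>
      pow_eq_zero_iff (n := 2) (by norm_num) |>.1
        ((Finset.sum_eq_zero_iff_of_nonneg fun _ _ => sq_nonneg _).1 hsum i hi)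
    have hα0 : α = 0 := Finset.sum_eq_zero fun i hi => by rw [hui i hi, zero_mul]
    have huv0 : uv = 0 := Finset.sum_eq_zero fun i hi => by rw [hui i hi, zero_mul]
    rw [hα0, huv0, ← hnu_z]
    simp
  rcases hnv0.eq_or_lt with hnv_z | hnv_pos
  · have hsum : ∑ i ∈ s, v i ^ 2 = 0 := by rw [← hnv2, ← hnv_z]; ring
    have hvi : ∀ i ∈ s, v i = 0 := fun i hi =>
      pow_eq_zero_iff (n := 2) (by norm_num) |>.1
        ((Finset.sum_eq_zero_iff_of_nonneg fun _ _ => sq_nonneg _).1 hsum i hi)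
    have hβ0 : β = 0 := Finset.sum_eq_zero fun i hi => by rw [hvi i hi, zero_mul]
    have huv0 : uv = 0 := Finset.sum_eq_zero fun i hi => by rw [hvi i hi, mul_zero]
    rw [hβ0, huv0, ← hnv_z]
    simp
  -- main case: divide by `2 nu nv > 0`
  have hpos : 0 < 2 * nu * nv := by positivity
  have key : 2 * nu * nv * ((uv - nu * nv) * X - 2 * α * β) ≤ 0 := by nlinarith [hCS, h4]
  have : (uv - nu * nv) * X - 2 * α * β ≤ 0 := by
    by_contra hcon
    push Not at hcon
    have := mul_pos hpos hcon
    linarith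
  linarith

/-- `Σ_{m ≤ M} 1/m ≤ 1 + log M`. [folklore] -/
private theorem sum_Icc_inv_le_log_rankTwo (M : ℕ) :
    ∑ m ∈ Finset.Icc 1 M, ((m : ℝ))⁻¹ ≤ 1 + Real.log M := by
  have hH := harmonic_le_one_add_log M
  simp_rw [harmonic_eq_sum_Icc, Rat.cast_sum, Rat.cast_inv, Rat.cast_natCast] at hH
  exact hH

/-- `Σ_{m ≤ M} m = M(M+1)/2` (as reals). [folklore] -/
private theorem sum_Icc_id_rankTwo (M : ℕ) :
    ∑ m ∈ Finset.Icc 1 M, (m : ℝ) = (M : ℝ) * ((M : ℝ) + 1) / 2 := by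
  induction M with
  | zero => simp
  | succ N ih =>
    rw [Finset.sum_Icc_succ_top (Nat.succ_le_succ (Nat.zero_le N)), ih]
    push_cast
    ring

/-- **The pole's Dirichlet sums, rank-two bound.** For every `M` and `a : ℕ → ℂ`:
`−(√((1 + log M)·M(M+1)/2) − M)·Σ‖a_m‖² ≤ 2 Re(A₋ conj A₊)`, `A₋ = Σ a_m (√m)⁻¹`, `A₊ = Σ a_m √m`. [folklore] -/
theorem two_mul_re_polar_ge (M : ℕ) (a : ℕ → ℂ) :
    -((Real.sqrt ((1 + Real.log M) * ((M : ℝ) * ((M : ℝ) + 1) / 2)) - M) *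
        ∑ m ∈ Finset.Icc 1 M, ‖a m‖ ^ 2) ≤
      2 * ((∑ m ∈ Finset.Icc 1 M, a m * ((Real.sqrt (m : ℝ) : ℝ) : ℂ)⁻¹) *
        conj (∑ m ∈ Finset.Icc 1 M, a m * ((Real.sqrt (m : ℝ) : ℝ) : ℂ))).re := by
  set s := Finset.Icc 1 M with hs
  set u : ℕ → ℝ := fun m => (Real.sqrt (m : ℝ))⁻¹ with hu
  set v : ℕ → ℝ := fun m => Real.sqrt (m : ℝ) with hv
  set xr : ℕ → ℝ := fun m => (a m).re with hxr
  set xi : ℕ → ℝ := fun m => (a m).im with hxi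
  -- real and imaginary parts of the two Dirichlet sums
  have hSm : (∑ m ∈ s, a m * ((Real.sqrt (m : ℝ) : ℝ) : ℂ)⁻¹) =
      ((∑ m ∈ s, u m * xr m : ℝ) : ℂ) + ((∑ m ∈ s, u m * xi m : ℝ) : ℂ) * I := by
    rw [Complex.ofReal_sum, Complex.ofReal_sum, Finset.sum_mul, ← Finset.sum_add_distrib]
    refine Finset.sum_congr rfl fun m _ => ?_
    rw [← Complex.ofReal_inv]
    apply Complex.ext <;> simp [hu, hxr, hxi] <;> ring
  have hSp : (∑ m ∈ s, a m * ((Real.sqrt (m : ℝ) : ℝ) : ℂ)) =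
      ((∑ m ∈ s, v m * xr m : ℝ) : ℂ) + ((∑ m ∈ s, v m * xi m : ℝ) : ℂ) * I := by
    rw [Complex.ofReal_sum, Complex.ofReal_sum, Finset.sum_mul, ← Finset.sum_add_distrib]
    refine Finset.sum_congr rfl fun m _ => ?_
    apply Complex.ext <;> simp [hv, hxr, hxi] <;> ring
  have hre : ((∑ m ∈ s, a m * ((Real.sqrt (m : ℝ) : ℝ) : ℂ)⁻¹) *
        conj (∑ m ∈ s, a m * ((Real.sqrt (m : ℝ) : ℝ) : ℂ))).re =
      (∑ m ∈ s, u m * xr m) * (∑ m ∈ s, v m * xr m) + (∑ m ∈ s, u m * xi m) * (∑ m ∈ s, v m * xi m) := by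
    rw [hSm, hSp]
    simp [Complex.mul_re]
  have hL : ∑ m ∈ s, ‖a m‖ ^ 2 = ∑ m ∈ s, xr m ^ 2 + ∑ m ∈ s, xi m ^ 2 := by
    rw [← Finset.sum_add_distrib]
    refine Finset.sum_congr rfl fun m _ => ?_
    rw [Complex.sq_norm, Complex.normSq_apply, hxr, hxi]
    ring
  -- the rank-two bound for both parts
  have h1 := rankTwo_rayleigh_ge s u v xr
  have h2 := rankTwo_rayleigh_ge s u v xi
  -- `u·v = M`, `‖u‖² ≤ 1 + log M`, `‖v‖² = M(M+1)/2`
  have huv : ∑ m ∈ s, u m * v m = M := by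
    have : ∀ m ∈ s, u m * v m = 1 := fun m hm => by
      have hm1 : (1 : ℝ) ≤ m := by exact_mod_cast (Finset.mem_Icc.mp hm).1
      have hpos : 0 < Real.sqrt (m : ℝ) := Real.sqrt_pos.2 (by linarith)
      rw [hu, hv]
      exact inv_mul_cancel₀ hpos.ne'
    rw [Finset.sum_congr rfl this, Finset.sum_const, Nat.card_Icc, Nat.add_sub_cancel, nsmul_eq_mul, mul_one]
  have hu2 : ∑ m ∈ s, u m ^ 2 ≤ 1 + Real.log M := by
    calc ∑ m ∈ s, u m ^ 2 = ∑ m ∈ s, ((m : ℝ))⁻¹ := Finset.sum_congr rfl fun m _ => by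
            rw [hu]; simp only [inv_pow, Real.sq_sqrt (Nat.cast_nonneg _)]
      _ ≤ 1 + Real.log M := sum_Icc_inv_le_log_rankTwo M
  have hv2 : ∑ m ∈ s, v m ^ 2 = (M : ℝ) * ((M : ℝ) + 1) / 2 := by
    calc ∑ m ∈ s, v m ^ 2 = ∑ m ∈ s, (m : ℝ) := Finset.sum_congr rfl fun m _ => by
            rw [hv]; simp only [Real.sq_sqrt (Nat.cast_nonneg _)]
      _ = _ := sum_Icc_id_rankTwo M
  -- monotonicity of the square roots
  have hU0 : 0 ≤ ∑ m ∈ s, u m ^ 2 := Finset.sum_nonneg fun _ _ => sq_nonneg _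
  have hsqrt : Real.sqrt (∑ m ∈ s, u m ^ 2) * Real.sqrt (∑ m ∈ s, v m ^ 2) ≤
      Real.sqrt ((1 + Real.log M) * ((M : ℝ) * ((M : ℝ) + 1) / 2)) := by
    rw [← Real.sqrt_mul hU0, hv2]
    exact Real.sqrt_le_sqrt (mul_le_mul_of_nonneg_right hu2 (by positivity))
  have hXr0 : 0 ≤ ∑ m ∈ s, xr m ^ 2 := Finset.sum_nonneg fun _ _ => sq_nonneg _
  have hXi0 : 0 ≤ ∑ m ∈ s, xi m ^ 2 := Finset.sum_nonneg fun _ _ => sq_nonneg _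
  rw [hre, hL]
  rw [huv] at h1 h2
  have h1' : ((M : ℝ) - Real.sqrt ((1 + Real.log M) * ((M : ℝ) * ((M : ℝ) + 1) / 2))) * ∑ m ∈ s, xr m ^ 2 ≤
      2 * (∑ m ∈ s, u m * xr m) * (∑ m ∈ s, v m * xr m) :=
    le_trans (mul_le_mul_of_nonneg_right (by linarith) hXr0) h1
  have h2' : ((M : ℝ) - Real.sqrt ((1 + Real.log M) * ((M : ℝ) * ((M : ℝ) + 1) / 2))) * ∑ m ∈ s, xi m ^ 2 ≤
      2 * (∑ m ∈ s, u m * xi m) * (∑ m ∈ s, v m * xi m) :=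
    le_trans (mul_le_mul_of_nonneg_right (by linarith) hXi0) h2
  nlinarith [h1', h2']

/-! ## The coercivity inequality -/

/-- `‖φ₀‖₂² > 0` for the fixed bump. [folklore] -/
private theorem weilNorm2Sq_shapeBump_pos_rankTwo :
    0 < weilNorm2Sq (fun u : ℝ => ((expNegInvGlue (1 - u ^ 2) : ℝ) : ℂ)) := by
  unfold weilNorm2Sq
  have hW := Summit.RiemannHypothesis.RiemannHypothesis.Theorems.weilComb_shapeBump_isWeilTest
  have hc : Continuous fun u : ℝ => ‖((expNegInvGlue (1 - u ^ 2) : ℝ) : ℂ)‖ ^ 2 :=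
    (hW.1.continuous.norm).pow 2
  have hs : HasCompactSupport fun u : ℝ => ‖((expNegInvGlue (1 - u ^ 2) : ℝ) : ℂ)‖ ^ 2 :=
    hW.2.norm.comp_left (g := fun r : ℝ => r ^ 2) (by simp)
  refine hc.integral_pos_of_hasCompactSupport_nonneg_nonzero hs (fun u => by positivity) (x := 0) ?_
  have h1 : 0 < expNegInvGlue (1 - (0 : ℝ) ^ 2) := expNegInvGlue.pos_of_pos (by norm_num)
  rw [Complex.norm_real, Real.norm_eq_abs, abs_of_pos h1]
  positivity

/-- `Re(F · conj F · z) = F² Re z` for real `F`. [folklore] -/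
private theorem re_ofReal_mul_conj_mul_rankTwo (F : ℝ) (z : ℂ) :
    ((F : ℂ) * conj (F : ℂ) * z).re = F ^ 2 * z.re := by
  rw [Complex.conj_ofReal, ← Complex.ofReal_mul, Complex.re_ofReal_mul]
  ring

/-- **PerronConeCoercivity, rank-two form (explicit, pole-exact).** For `0 < ε`, `1 ≤ M`, `2ε(M+1) ≤ 1` and every `a`:
`ε⁻¹‖φ₀‖₂² · ( D(a) − Δ(a) − C₂·‖a‖² ) ≤ Re Q(g)` with
`Δ(a) = (log M + 1 + log π − ρ(0))‖a‖² − (ε/‖φ₀‖₂²)·(1/2π)∫|ĝ(1/2+iu)|²(ρ(u) − ρ(0))du` and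
`C₂ = (F_ε² ε / ‖φ₀‖₂²)·(√((1 + log M)·M(M+1)/2) − M)`. [folklore] -/
theorem window_coercivity_rank2 : ∀ ε : ℝ, 0 < ε → ∀ (M : ℕ) (a : ℕ → ℂ), 1 ≤ M → 2 * ε * ((M : ℝ) + 1) ≤ 1 →
    ε⁻¹ * weilNorm2Sq (fun u : ℝ => ((expNegInvGlue (1 - u ^ 2) : ℝ) : ℂ)) *
        ((∑ m ∈ Finset.Icc 1 M, ∑ n ∈ Finset.Icc 1 (M / m),
            (ArithmeticFunction.vonMangoldt n : ℝ) * ‖a (n * m) - ((Real.sqrt n : ℂ))⁻¹ * a m‖ ^ 2) -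
          ((Real.log M + 1 + Real.log Real.pi - reDigammaQuarter 0) * (∑ m ∈ Finset.Icc 1 M, ‖a m‖ ^ 2) -
            ε / weilNorm2Sq (fun u : ℝ => ((expNegInvGlue (1 - u ^ 2) : ℝ) : ℂ)) *
              (1 / (2 * Real.pi) * ∫ u : ℝ, ‖weilMellin (fun x : ℝ => ∑ m ∈ Finset.Icc 1 M,
                a m * ((ε : ℂ)⁻¹ * ((expNegInvGlue (1 - ((x - Real.log (m : ℝ)) / ε) ^ 2) : ℝ) : ℂ)))
                  (1 / 2 + u * I)‖ ^ 2 * (reDigammaQuarter u - reDigammaQuarter 0))) -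
          (∫ u : ℝ, expNegInvGlue (1 - u ^ 2) * Real.cosh (ε * u / 2)) ^ 2 * ε /
              weilNorm2Sq (fun u : ℝ => ((expNegInvGlue (1 - u ^ 2) : ℝ) : ℂ)) *
            (Real.sqrt ((1 + Real.log M) * ((M : ℝ) * ((M : ℝ) + 1) / 2)) - M) *
            (∑ m ∈ Finset.Icc 1 M, ‖a m‖ ^ 2)) ≤
      (weilQuadratic (fun x : ℝ => ∑ m ∈ Finset.Icc 1 M,
        a m * ((ε : ℂ)⁻¹ * ((expNegInvGlue (1 - ((x - Real.log (m : ℝ)) / ε) ^ 2) : ℝ) : ℂ)))).re := by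
  intro ε hε M a hM hw
  -- the two stubs, the exact identity, the pole coefficient and the rank-two bound (BEFORE naming the atoms)
  have hHe := stub_helson_upper M a
  have hAr := stub_arch_window ε hε M a hw
  have hQ := weilQuadratic_comb_re_exactWindow ε hε M a hM hw
  have hPol := weilPolarTerm_comb_re ε hε M a
  obtain ⟨hF0, hF1, hFpos⟩ := weilMellin_dilBump_zero_one ε hε
  rw [hF0, hF1] at hPol
  have hR2 := two_mul_re_polar_ge M a
  rw [hQ, hPol, hAr]
  -- names for the real atoms
  set N₀ : ℝ := weilNorm2Sq (fun u : ℝ => ((expNegInvGlue (1 - u ^ 2) : ℝ) : ℂ)) with hN₀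
  set F : ℝ := ∫ u : ℝ, expNegInvGlue (1 - u ^ 2) * Real.cosh (ε * u / 2) with hFdef
  set L : ℝ := ∑ m ∈ Finset.Icc 1 M, ‖a m‖ ^ 2 with hL
  set D : ℝ := ∑ m ∈ Finset.Icc 1 M, ∑ n ∈ Finset.Icc 1 (M / m),
      (ArithmeticFunction.vonMangoldt n : ℝ) * ‖a (n * m) - ((Real.sqrt n : ℂ))⁻¹ * a m‖ ^ 2 with hDdef
  set H : ℝ := 2 * (∑ m ∈ Finset.Icc 1 M, ∑ n ∈ Finset.Icc 1 (M / m),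
      ((ArithmeticFunction.vonMangoldt n : ℝ) : ℂ) / (Real.sqrt n : ℂ) * a (n * m) * conj (a m)).re with hH
  set P : ℝ := 1 / (2 * Real.pi) * ∫ u : ℝ, ‖weilMellin (fun x : ℝ => ∑ m ∈ Finset.Icc 1 M,
      a m * ((ε : ℂ)⁻¹ * ((expNegInvGlue (1 - ((x - Real.log (m : ℝ)) / ε) ^ 2) : ℝ) : ℂ)))
        (1 / 2 + u * I)‖ ^ 2 * (reDigammaQuarter u - reDigammaQuarter 0) with hP
  set Sm : ℂ := ∑ m ∈ Finset.Icc 1 M, a m * ((Real.sqrt (m : ℝ) : ℝ) : ℂ)⁻¹ with hSm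
  set Sp : ℂ := ∑ m ∈ Finset.Icc 1 M, a m * ((Real.sqrt (m : ℝ) : ℝ) : ℂ) with hSp
  set c : ℝ := Real.log M + 1 + Real.log Real.pi - reDigammaQuarter 0 with hc
  set c₂ : ℝ := Real.sqrt ((1 + Real.log M) * ((M : ℝ) * ((M : ℝ) + 1) / 2)) - M with hc₂
  have hN₀pos : 0 < N₀ := weilNorm2Sq_shapeBump_pos_rankTwo
  have hεU : 0 < ε⁻¹ * N₀ := mul_pos (inv_pos.2 hε) hN₀pos
  set U : ℝ := ε⁻¹ * N₀ with hU
  -- polar: `Re P(k) = 2F² Re(Sm conj Sp) ≥ −F² c₂ L`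
  have hPolar_ge : -(F ^ 2 * (c₂ * L)) ≤ 2 * ((F : ℂ) * conj (F : ℂ) * (Sm * conj Sp)).re := by
    rw [re_ofReal_mul_conj_mul_rankTwo]
    have hF2 : 0 ≤ F ^ 2 := sq_nonneg F
    have := mul_le_mul_of_nonneg_left hR2 hF2
    linarith
  -- Helson: `U H ≤ U ((log M + 1) L − D)`
  have hHel : U * H ≤ U * ((Real.log M + 1) * L - D) := mul_le_mul_of_nonneg_left hHe hεU.le
  -- constants in terms of `U`
  have hεN : ε / N₀ = U⁻¹ := by
    rw [hU, mul_inv, inv_inv]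
    ring
  have hFc : F ^ 2 * ε / N₀ * c₂ * L = F ^ 2 * (c₂ * L) * U⁻¹ := by
    rw [hU, mul_inv, inv_inv]
    ring
  rw [hεN, hFc]
  have e : U * (D - (c * L - U⁻¹ * P) - F ^ 2 * (c₂ * L) * U⁻¹) = U * D - c * (U * L) + P - F ^ 2 * (c₂ * L) := by
    field_simp
    ring
  rw [e, hc]
  linarith [hPolar_ge, hHel]

/-- **The dichotomy, rank-two form (corollary).** For `0 < ε`, `1 ≤ M`, `2ε(M+1) ≤ 1`: if `a` lies OFF the cone
`{D ≤ Δ + C₂‖a‖²}`, the window cell holds at `a` (`0 ≤ Re Q(g)`); so Theorem B is equivalent to its restriction to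
that cone. [folklore] -/
theorem window_dichotomy_rank2 : ∀ ε : ℝ, 0 < ε → ∀ (M : ℕ) (a : ℕ → ℂ), 1 ≤ M → 2 * ε * ((M : ℝ) + 1) ≤ 1 →
    (Real.log M + 1 + Real.log Real.pi - reDigammaQuarter 0) * (∑ m ∈ Finset.Icc 1 M, ‖a m‖ ^ 2) -
          ε / weilNorm2Sq (fun u : ℝ => ((expNegInvGlue (1 - u ^ 2) : ℝ) : ℂ)) *
            (1 / (2 * Real.pi) * ∫ u : ℝ, ‖weilMellin (fun x : ℝ => ∑ m ∈ Finset.Icc 1 M,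
              a m * ((ε : ℂ)⁻¹ * ((expNegInvGlue (1 - ((x - Real.log (m : ℝ)) / ε) ^ 2) : ℝ) : ℂ)))
                (1 / 2 + u * I)‖ ^ 2 * (reDigammaQuarter u - reDigammaQuarter 0)) +
        (∫ u : ℝ, expNegInvGlue (1 - u ^ 2) * Real.cosh (ε * u / 2)) ^ 2 * ε /
            weilNorm2Sq (fun u : ℝ => ((expNegInvGlue (1 - u ^ 2) : ℝ) : ℂ)) *
          (Real.sqrt ((1 + Real.log M) * ((M : ℝ) * ((M : ℝ) + 1) / 2)) - M) *
          (∑ m ∈ Finset.Icc 1 M, ‖a m‖ ^ 2) <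
      (∑ m ∈ Finset.Icc 1 M, ∑ n ∈ Finset.Icc 1 (M / m),
        (ArithmeticFunction.vonMangoldt n : ℝ) * ‖a (n * m) - ((Real.sqrt n : ℂ))⁻¹ * a m‖ ^ 2) →
    0 ≤ (weilQuadratic (fun x : ℝ => ∑ m ∈ Finset.Icc 1 M,
        a m * ((ε : ℂ)⁻¹ * ((expNegInvGlue (1 - ((x - Real.log (m : ℝ)) / ε) ^ 2) : ℝ) : ℂ)))).re := by
  intro ε hε M a hM hw hcone
  have h := window_coercivity_rank2 ε hε M a hM hw
  have hU : 0 ≤ ε⁻¹ * weilNorm2Sq (fun u : ℝ => ((expNegInvGlue (1 - u ^ 2) : ℝ) : ℂ)) :=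
    mul_nonneg (inv_nonneg.2 hε.le) (weilNorm2Sq_nonneg _)
  refine le_trans (mul_nonneg hU ?_) h
  linarith

end Summit.RiemannHypothesis.RiemannHypothesis.Theorems.WeilCombBohrFejer

end
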